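import Summits.AnomalousDissipation.AnomalousDissipation.Theorems.TwoAndHalfDScalarLift2halfDRForcedLimit
import Summits.AnomalousDissipation.AnomalousDissipation.Theorems.TwoAndHalfDScalarLift2halfDRGlueTools
import Summits.AnomalousDissipation.AnomalousDissipation.Theorems.LimitingAbsorptionKinematicSteadySourceLawToolkit
import HarnessLib

/-!
# Crux `LimitingAbsorption.FloorUpgrade` (stmt-AnomalousDissipation-15010), line
# `material-derivative-dichotomy`, stub `stub_sourcedSolution`: global weak SOURCED scalars in a
# locally bounded Leray–Hopf drift

For `κ > 0`, a smooth steady source `h` and a global Leray–Hopf velocity `v` on `T²` that is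
essentially bounded on every slab `(0,T) × T²`, the weak solution of `∂ₜθ + v·∇θ = κΔθ + h`,
`θ(0) = 0` exists GLOBALLY (one `θ` for every horizon `T`,
`Torus.IsWeakScalarTransportForced`). Sourced twin of
`RelaxingFamily.Negative.exists_global_isWeakScalarTransportOn`:

* `isWeakScalarTransportForcedOn_congr_ae_slice` — the sourced weak class is stable under
  modification of the scalar on a null set of time slices (slice-wise a.e.), given space–time
  measurability of the new field;
* `exists_global_isWeakScalarTransportForcedOn` — **gluing**: from solutions `ϑₙ` on the horizons
  `n + 1` the field `θ(t) := ϑ_{⌊t⌋}(t)` is a weak sourced solution on every `[0,T)` (it agrees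
  slice-wise a.e. with `ϑ_{⌈T⌉}` on `(0,T)` by bounded-drift uniqueness
  `KinematicSteadySourceLaw.forced_ae_eq_of_memLp_top`, and is space–time measurable strip by strip);
* `exists_isWeakScalarTransportForcedOn_of_isGlobalLerayHopf` — per-horizon existence in a global
  Leray–Hopf drift (window existence `exists_isWeakScalarTransportForcedOn_of_sq` fed with the
  `L^∞_t L²_x` bound `energy_bound` and weak incompressibility of the Leray–Hopf structure);
* `stub_sourcedSolution` — the registered stub.

## References

* R. J. DiPerna, P.-L. Lions, Invent. Math. 98 (1989), §II.1, Prop. II.1 (weak class, existence by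
  regularisation). [`DiPernaLions1989`]
* T. Drivas, T. Elgindi, G. Iyer, I.-J. Jeong, ARMA 243 (2022), (1.1), (1.3) (sourced equation,
  energy/uniqueness for bounded drift). [`DEIJ2022`]
-/

noncomputable section

open MeasureTheory Set Filter Topology Function
open scoped ENNReal NNReal InnerProductSpace

namespace Summit.AnomalousDissipation.AnomalousDissipation.Theorems.FloorUpgradeMDD

-- D-0017: single-problem summit ⇒ `Summit.AnomalousDissipation.AnomalousDissipation.…` by design.
set_option linter.dupNamespace false

open Literature.Analysis Literature.Analysis.FluidPDE Literature.Analysis.FluidPDE.Torus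

variable {d : Type*} [Fintype d]

/-! ## Modification on a null set of slices (sourced class) -/

section CongrAE

variable {T κ : ℝ} {u : ℝ → UnitAddTorus d → EuclideanSpace ℝ d} {s : ℝ → UnitAddTorus d → ℝ}
  {θ₀ : UnitAddTorus d → ℝ} {θ θ' : ℝ → UnitAddTorus d → ℝ}

/-- **The sourced weak class is stable under a.e.-slice modification.** If `θ'` is a weak
solution of `∂ₜθ + u·∇θ = κΔθ + s` on `[0,T)` with datum `θ₀`, `θ` is space–time measurable on
`(0,T) × T^d` and `θ(t) = θ'(t)` a.e. on `T^d` for a.e. `t ∈ (0,T)`, then `θ` is a weak solution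
on `[0,T)` with the same drift, source and datum (every scalar-side conjunct of
`Torus.IsWeakScalarTransportForcedOn` is an a.e.-in-time statement about, or an iterated integral
of, the slices; the source-side conjuncts are untouched). Sourced copy of
`RelaxingFamily.Negative.isWeakScalarTransportOn_congr_ae_slice`. [folklore] -/
theorem isWeakScalarTransportForcedOn_congr_ae_slice (h : IsWeakScalarTransportForcedOn T κ u s θ₀ θ')
    (hm : AEStronglyMeasurable (FunctionSpaces.Torus.stLift θ) (volume.restrict (Ioo 0 T ×ˢ univ)))
    (hae : ∀ᵐ t ∂(volume.restrict (Ioo 0 T)), θ t =ᵐ[volume] θ' t) :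
    IsWeakScalarTransportForcedOn T κ u s θ₀ θ where
  aestronglyMeasurable := hm
  aestronglyMeasurable_velocity := h.aestronglyMeasurable_velocity
  aestronglyMeasurable_source := h.aestronglyMeasurable_source
  ae_lintegral_sq_le := by
    obtain ⟨C, hC⟩ := h.ae_lintegral_sq_le
    refine ⟨C, ?_⟩
    filter_upwards [hC, hae] with t ht hte
    calc ∫⁻ x, ‖θ t x‖ₑ ^ 2 = ∫⁻ x, ‖θ' t x‖ₑ ^ 2 :=
          lintegral_congr_ae (hte.mono fun x hx => by beta_reduce; rw [hx])
      _ ≤ C := ht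
  lintegral_velocity_lt_top := h.lintegral_velocity_lt_top
  lintegral_mul_lt_top := by
    calc ∫⁻ t in Ioo 0 T, ∫⁻ x, ‖u t x‖ₑ * ‖θ t x‖ₑ
          = ∫⁻ t in Ioo 0 T, ∫⁻ x, ‖u t x‖ₑ * ‖θ' t x‖ₑ :=
          lintegral_congr_ae (hae.mono fun t hte => lintegral_congr_ae (hte.mono fun x hx => by beta_reduce; rw [hx]))
      _ < ⊤ := h.lintegral_mul_lt_top
  lintegral_source_lt_top := h.lintegral_source_lt_top
  ae_isWeaklyDivFree := h.ae_isWeaklyDivFree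
  weak_eq ψ hψ := by
    have e : (∫ t in Ioo 0 T, ∫ x, θ t x *
        (FunctionSpaces.Torus.timeDeriv ψ t x + ⟪u t x, FunctionSpaces.Torus.gradient (ψ t) x⟫_ℝ +
          κ * FunctionSpaces.Torus.laplacian (ψ t) x)) =
        ∫ t in Ioo 0 T, ∫ x, θ' t x *
        (FunctionSpaces.Torus.timeDeriv ψ t x + ⟪u t x, FunctionSpaces.Torus.gradient (ψ t) x⟫_ℝ +
          κ * FunctionSpaces.Torus.laplacian (ψ t) x) :=
      integral_congr_ae (hae.mono fun t hte => integral_congr_ae (hte.mono fun x hx => by beta_reduce; rw [hx]))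
    rw [e]
    exact h.weak_eq ψ hψ

end CongrAE

/-! ## Gluing per-horizon sourced solutions into a global one -/

section Glue

variable {κ : ℝ} {u : ℝ → UnitAddTorus d → EuclideanSpace ℝ d} {s : ℝ → UnitAddTorus d → ℝ}
  {θ₀ : UnitAddTorus d → ℝ}

/-- **Global weak sourced scalars from per-horizon ones (bounded drift).** Let `κ > 0` and let the
drift `u` be essentially bounded on `(0,T) × T^d` for every `T > 0`. If for every `T > 0` the
problem `∂ₜθ + u·∇θ = κΔθ + s`, `θ(0) = θ₀` has a weak solution on `[0,T)`, then it has ONE weak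
solution on `[0,T)` for all `T > 0` simultaneously: with `ϑₙ` a solution on `[0, n+1)`, the glued
field `θ(t) := ϑ_{⌊t⌋}(t)` agrees with `ϑ_N` (`N = ⌈T⌉`) for a.e. slice `t ∈ (0,T)` by uniqueness
for bounded drift (`KinematicSteadySourceLaw.forced_ae_eq_of_memLp_top`), hence solves on `[0,T)`
(`isWeakScalarTransportForcedOn_congr_ae_slice`). Sourced copy of
`RelaxingFamily.Negative.exists_global_isWeakScalarTransportOn`. [folklore] -/
theorem exists_global_isWeakScalarTransportForcedOn (hκ : 0 < κ)
    (hu : ∀ T : ℝ, 0 < T →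
      MemLp (FunctionSpaces.Torus.stLift u) ∞ (volume.restrict (Ioo 0 T ×ˢ univ)))
    (hex : ∀ T : ℝ, 0 < T → ∃ θ : ℝ → UnitAddTorus d → ℝ, IsWeakScalarTransportForcedOn T κ u s θ₀ θ) :
    ∃ θ : ℝ → UnitAddTorus d → ℝ, IsWeakScalarTransportForced κ u s θ₀ θ := by
  have hn : ∀ n : ℕ, (0 : ℝ) < n + 1 := fun n => by positivity
  choose ϑ hϑ using fun n : ℕ => hex ((n : ℝ) + 1) (hn n)
  refine ⟨fun t => ϑ ⌊t⌋₊ t, fun T hT => ?_⟩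
  set N : ℕ := ⌈T⌉₊ with hN
  have hTN : T ≤ (N : ℝ) + 1 := (Nat.le_ceil T).trans (le_add_of_nonneg_right zero_le_one)
  have hsolN : IsWeakScalarTransportForcedOn T κ u s θ₀ (ϑ N) :=
    isWeakScalarTransportForcedOn_of_le (hϑ N) hTN
  refine isWeakScalarTransportForcedOn_congr_ae_slice hsolN ?_ ?_
  · -- space–time measurability, strip by strip
    set μ : Measure (ℝ × EuclideanSpace ℝ d) := volume.restrict (Ioo 0 T ×ˢ univ) with hμ
    let S : ℕ → Set (ℝ × EuclideanSpace ℝ d) := fun n => {p | ⌊p.1⌋₊ = n}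
    have hS : ∀ n, MeasurableSet (S n) := fun n =>
      (Nat.measurable_floor.comp measurable_fst) (measurableSet_singleton n)
    have hU : (⋃ n, S n) = univ := by
      ext p
      simp only [mem_iUnion, mem_setOf_eq, mem_univ, iff_true, S]
      exact ⟨_, rfl⟩
    have key : ∀ n, AEStronglyMeasurable (FunctionSpaces.Torus.stLift fun t => ϑ ⌊t⌋₊ t)
        (μ.restrict (S n)) := by
      intro n
      have hsub : (S n ∩ Ioo 0 T ×ˢ (univ : Set (EuclideanSpace ℝ d))) ⊆ Ioo 0 ((n : ℝ) + 1) ×ˢ univ := by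
        rintro ⟨t, y⟩ ⟨hts, hty⟩
        refine ⟨⟨(mem_prod.1 hty).1.1, ?_⟩, mem_univ _⟩
        have : ⌊t⌋₊ = n := hts
        rw [← this]
        exact Nat.lt_floor_add_one t
      have hle : μ.restrict (S n) ≤ volume.restrict (Ioo 0 ((n : ℝ) + 1) ×ˢ univ) := by
        rw [hμ, Measure.restrict_restrict (hS n)]
        exact Measure.restrict_mono hsub le_rfl
      have h1 : AEStronglyMeasurable (FunctionSpaces.Torus.stLift (ϑ n)) (μ.restrict (S n)) :=
        (hϑ n).aestronglyMeasurable.mono_measure hle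
      refine h1.congr ?_
      have hmem : ∀ᵐ p ∂(μ.restrict (S n)), p ∈ S n := ae_restrict_mem (hS n)
      filter_upwards [hmem] with p hp
      obtain ⟨t, y⟩ := p
      have : ⌊t⌋₊ = n := hp
      simp only [FunctionSpaces.Torus.stLift_apply, this]
    have := (aestronglyMeasurable_iUnion_iff (μ := μ) (s := S)).2 key
    rwa [hU, Measure.restrict_univ] at this
  · -- a.e. slice: `ϑ_{⌊t⌋} (t) = ϑ_N (t)` a.e. on `T^d`, for a.e. `t ∈ (0,T)`
    have hall : ∀ n : ℕ, ∀ᵐ t ∂(volume.restrict (Ioo 0 T)),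
        ⌊t⌋₊ = n → ϑ n t =ᵐ[volume] ϑ N t := by
      intro n
      rcases le_or_gt n N with hnN | hnN
      · have hle : (n : ℝ) + 1 ≤ (N : ℝ) + 1 := by exact_mod_cast Nat.succ_le_succ hnN
        have huniq := KinematicSteadySourceLaw.forced_ae_eq_of_memLp_top hκ (hϑ n)
          (isWeakScalarTransportForcedOn_of_le (hϑ N) hle) (hu _ (hn n))
        rw [ae_restrict_iff' measurableSet_Ioo] at huniq ⊢
        filter_upwards [huniq] with t ht htT hfl
        refine ht ⟨htT.1, ?_⟩
        rw [← hfl]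
        exact Nat.lt_floor_add_one t
      · rw [ae_restrict_iff' measurableSet_Ioo]
        refine Eventually.of_forall fun t htT hfl => absurd hfl (ne_of_lt ?_)
        calc ⌊t⌋₊ ≤ ⌊T⌋₊ := Nat.floor_le_floor htT.2.le
          _ ≤ ⌈T⌉₊ := Nat.floor_le_ceil T
          _ < n := hnN
    have hall' := ae_all_iff.2 hall
    filter_upwards [hall'] with t ht
    exact ht ⌊t⌋₊ rfl

end Glue

/-! ## Per-horizon existence in a global Leray–Hopf drift, and the stub -/

section LerayHopf

variable [DecidableEq d]

/-- **Weak sourced scalars in a global Leray–Hopf drift, per horizon.** For a global Leray–Hopf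
velocity `v` on `T^d` (any viscosity, force, datum), `κ > 0`, `T > 0`, an `L²` datum `θ₀` and a
smooth steady source `σ`, the problem `∂ₜθ + v·∇θ = κΔθ + σ`, `θ(0) = θ₀` has a weak solution on
`[0,T)`, provided `v` is space–time measurable on the slab (window existence
`exists_isWeakScalarTransportForcedOn_of_sq`, fed with the `L^∞_t L²_x` bound `energy_bound` and the
weak incompressibility of the Leray–Hopf structure on the horizon `T`, as in
`Torus.IsGlobalLerayHopf.exists_release`). [folklore] -/
theorem exists_isWeakScalarTransportForcedOn_of_isGlobalLerayHopf {ν κ T : ℝ}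
    {f : ℝ → UnitAddTorus d → EuclideanSpace ℝ d} {v₀ : UnitAddTorus d → EuclideanSpace ℝ d}
    {v : ℝ → UnitAddTorus d → EuclideanSpace ℝ d} (hv : IsGlobalLerayHopf ν f v₀ v) (hκ : 0 < κ)
    (hT : 0 < T) {θ₀ : UnitAddTorus d → ℝ} (hθ₀ : MemLp θ₀ 2 volume)
    (hum : AEStronglyMeasurable (FunctionSpaces.Torus.stLift v) (volume.restrict (Ioo 0 T ×ˢ univ)))
    {σ : UnitAddTorus d → ℝ} (hσ : FunctionSpaces.Torus.IsSmooth σ) :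
    ∃ θ : ℝ → UnitAddTorus d → ℝ, IsWeakScalarTransportForcedOn T κ v (fun _ => σ) θ₀ θ := by
  obtain ⟨M, hM⟩ := (hv T hT).energy_bound
  exact exists_isWeakScalarTransportForcedOn_of_sq hκ hT hθ₀ hum hM
    (hv T hT).weak.ae_isWeaklyDivFree hσ

end LerayHopf

/-- **`stub_sourcedSolution`.** For `κ > 0`, a smooth steady source `h` and a global Leray–Hopf
velocity `v` on `T²` (any viscosity `ν`, steady force `g`, datum `v₀`) that is essentially bounded
on every slab `(0,T) × T²`, the weak solution of `∂ₜθ + v·∇θ = κΔθ + h`, `θ(0) = 0` exists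
GLOBALLY (one `θ` serving every horizon `T`): per-horizon existence
(`exists_isWeakScalarTransportForcedOn_of_isGlobalLerayHopf`, DiPerna–Lions regularisation) glued
along the horizons `n + 1` by bounded-drift uniqueness
(`exists_global_isWeakScalarTransportForcedOn`). [folklore] -/
theorem stub_sourcedSolution :
    ∀ (ν κ : ℝ) (g : UnitAddTorus (Fin 2) → EuclideanSpace ℝ (Fin 2)) (h : UnitAddTorus (Fin 2) → ℝ)
      (v₀ : UnitAddTorus (Fin 2) → EuclideanSpace ℝ (Fin 2))
      (v : ℝ → UnitAddTorus (Fin 2) → EuclideanSpace ℝ (Fin 2)),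
      0 < κ → FunctionSpaces.Torus.IsSmooth h →
      IsGlobalLerayHopf ν (fun _ => g) v₀ v →
      (∀ T : ℝ, 0 < T →
        MemLp (FunctionSpaces.Torus.stLift v) ⊤ (volume.restrict (Ioo (0 : ℝ) T ×ˢ univ))) →
      ∃ θ : ℝ → UnitAddTorus (Fin 2) → ℝ, IsWeakScalarTransportForced κ v (fun _ => h) 0 θ := by
  intro ν κ g h v₀ v hκ hh hLH hbd
  exact exists_global_isWeakScalarTransportForcedOn hκ hbd fun T hT =>
    exists_isWeakScalarTransportForcedOn_of_isGlobalLerayHopf hLH hκ hT MemLp.zero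
      (hbd T hT).aestronglyMeasurable hh

end Summit.AnomalousDissipation.AnomalousDissipation.Theorems.FloorUpgradeMDD

end
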